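import Summits.CriticalPhenomena.PercolationContinuityZ3.Theorems.Transplant.TwoAxisParaCellsFine
import Summits.CriticalPhenomena.PercolationContinuityZ3.Theorems.Transplant.TwoAxisExitFrameQ
import HarnessLib

/-!
# WAVE-Q binder row Q21 «TwoAxisParaCellsFine» ↦ «TwoAxisParaCellsFineQ» (quasi-step rung (N3-b); table v0.7 level L1; captain/pen gen-1 g4):
# the u-face and v-face frames of the fine two-axis skeleton have `3M`-quasi-steps under (ι) := `Skelφ.QStepsN G φ M`

builds on p205010 (kernel theorem, internal audit signed; external expert review pending) — nothing in this file uses p205010; nothing here is a claim about any open node; no carrier,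
no node, no definition.  Lane `prim-bschramm`, seat `prim-bschramm-gen-1` (gen 4).  Helper file (`--supports stmt-CriticalPhenomena-4575 --as helper`).
The ONLY in-cone declarations of «TwoAxisParaCellsFine» that take `(hstep : Steps G φ)` are `qSteps_uFrame` / `qSteps_vFrame` (conclusion `QSteps G (uFrame …)`,
consumed through `qStepsN_of_qSteps` by the face-kit files); their twins conclude `QStepsN G (uFrame …) (3 * M)` directly (hunk classes (i) binder, (ii) call
`qSteps_exitFrame ↦ qStepsN_exitFrame_of_qStepsN` (row α4, p505635), (iv) cost token `1 ↦ 3M`); every other binder byte-identical; `fineSkel`/`uFrame`/`vFrame` and the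
`Read` section are step-free and imported, not copied.  Regression: `qStepsN_of_steps` (M = 1) recovers cost 3 ≥ the old `qStepsN_of_qSteps` cost 1 only as an upper
bound — downstream kit rows take the cost as the common bound `P.N` (captain ruling R-1 (b), 2026-08-27).
* **`qStepsN_uFrame_q`**, **`qStepsN_vFrame_q`**.
-/

namespace Summit.CriticalPhenomena.PercolationContinuityZ3.Theorems.Transplant

open Literature.Probability.LatticeModels

namespace Skelφ

open Literature.Probability.Percolation.KozmaNitzan.Cells (oth oth_ne eq_oth_of_ne oth_oth)
open TwoAxis.Para (coarse lam0 lam1 modulus)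
variable {V : Type} {G : SimpleGraph V} {φ : V → Site 2}

/-- **The u-face frame has `3M`-quasi-steps when `φ` has `M`-quasi-steps** (twin of `qSteps_uFrame`, `Steps G φ ↦ QStepsN G φ M`, via `qStepsN_exitFrame_of_qStepsN` p505635): raw axis `b` with `|coef b| ≤ |coef (oth b)|` (i.e. `b = 0` when `|h| ≤ |n|`, `b = 1` when `|n| ≤ |h|`),
the inward coefficient nonzero, and `c₁|A|(|n|+|h|) ≤ D ≤ 3·|inward coefficient|` (fine unit at most `3/2` Lipschitz units). [this work] -/
theorem qStepsN_uFrame_q {M : ℕ} (hq : QStepsN G φ M) (t : V) {A n h c₁ s₁ D : ℤ} {b : Fin 2} (hc₁ : 0 ≤ c₁) (hD : 0 < D)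
    (hL1 : c₁ * (|A| * (|n| + |h|)) ≤ D)
    (hab : |coef (-(c₁ * A * h)) (c₁ * A * n) b| ≤ |coef (-(c₁ * A * h)) (c₁ * A * n) (oth b)|)
    (hca : 0 < |coef (-(c₁ * A * h)) (c₁ * A * n) (oth b)|) (hU3 : D ≤ 3 * |coef (-(c₁ * A * h)) (c₁ * A * n) (oth b)|) :
    QStepsN G (uFrame φ t A n h c₁ s₁ D b) (3 * M) :=
  qStepsN_exitFrame_of_qStepsN t hq hD (by rw [abs_ucoef c₁ A n h hc₁]; exact hL1) hab hca hU3

/-- **The v-face frame has `3M`-quasi-steps when `φ` has `M`-quasi-steps** (twin of `qSteps_vFrame`) (raw axis `b = 1` when `|vα| ≤ |vβ|`, `b = 0` when `|vβ| ≤ |vα|`). [this work] -/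
theorem qStepsN_vFrame_q {M : ℕ} (hq : QStepsN G φ M) (t : V) {A vα vβ c₀ s₀ D : ℤ} {b : Fin 2} (hc₀ : 0 ≤ c₀) (hD : 0 < D)
    (hL0 : c₀ * (|A| * (|vβ| + |vα|)) ≤ D)
    (hab : |coef (c₀ * A * vβ) (-(c₀ * A * vα)) b| ≤ |coef (c₀ * A * vβ) (-(c₀ * A * vα)) (oth b)|)
    (hca : 0 < |coef (c₀ * A * vβ) (-(c₀ * A * vα)) (oth b)|) (hU3 : D ≤ 3 * |coef (c₀ * A * vβ) (-(c₀ * A * vα)) (oth b)|) :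
    QStepsN G (vFrame φ t A vα vβ c₀ s₀ D b) (3 * M) :=
  qStepsN_exitFrame_of_qStepsN t hq hD (by rw [abs_vcoef c₀ A vα vβ hc₀]; exact hL0) hab hca hU3

end Skelφ

end Summit.CriticalPhenomena.PercolationContinuityZ3.Theorems.Transplant
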